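import Mathlib
import Literature.Analysis.PDE.Wave1DSpatialReflection
import Literature.Analysis.PDE.Wave1DChannelScaling
import Summits.FinalStateConjecture.FinalStateConjecture.Theorems.PhotonSphereChannelsFarZeroNear
import Summits.FinalStateConjecture.FinalStateConjecture.Theorems.PhotonSphereChannelsFarChannelsPos
import Summits.FinalStateConjecture.FinalStateConjecture.Theorems.PhotonSphereChannelsFarPotentialAsymptotics
import Summits.FinalStateConjecture.FinalStateConjecture.Theorems.PhotonSphereChannelsFixedModeReduction
import Summits.FinalStateConjecture.FinalStateConjecture.Theorems.PhotonSphereChannelsNearChannels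

/-!
# Route PhotonSphereChannels — `FixedModeChannels` (item stmt-FinalStateConjecture-10048), closed

The per-mode two-ended exterior channel inequality for the Regge–Wheeler family. Assembly:
* the near half `Theorems.nearHalfLineChannels` (landed earlier);
* the far half for the modes `ℓ ≥ 1`: `Theorems.farHalfLineChannels_pos` (true `t`-polynomial kernel,
  exact inverse-square channel inequality, Duhamel comparison, kernel transfer, absorption);
* the far half for the mode `ℓ = 0` (`s = 0`): the unit-scale far channel estimate for potentials
  `0 ≤ W ≤ ε y^{−5/2}` (`unitFarChannel_zero`, the spatial reflection of
  `Theorems.nearChannel_zero_of_rpow_tail`) transported to the edge `xc + ρ` by the rescaling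
  `W(y) = ρ² V(xc + ρy)` (`Theorems.rwPotential_rescaled_close`,
  `Literature.Analysis.PDE.farChannelInequality_of_unitScale`; this step repeats, for one mode, the
  argument of `Theorems.farHalfLineChannels_of_unitFarChannel`);
* the glue `Theorems.fixedModeChannels_of_near_far`.
`fixedModeChannels_proof` has exactly the type of the route decl
`Summit.FinalStateConjecture.FinalStateConjecture.Theses.PhotonSphereChannels.FixedModeChannels`; the
route module is not imported (so that the gate-rendered route file can import this module).
-/

noncomputable section

namespace Summit.FinalStateConjecture.FinalStateConjecture.Theorems

open MeasureTheory Set Filter Topology Literature.Analysis.PDE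
open scoped ENNReal

/-! ### Reflection `x ↦ −x`: near form to far form -/

/-- **A near-cone channel inequality for `(V, ψ)` is a far-cone one for the reflected pair**
`(W, φ) = (V(−·), ψ(·,−·))`, edge `−1 ↦ 1`, same constant. -/
theorem farChannel_of_near_reflect {V W : ℝ → ℝ} {ψ φ : ℝ → ℝ → ℝ} {c : ℝ}
    (hVW : ∀ x, V x = W (-x)) (hψφ : ∀ t x, ψ t x = φ t (-x))
    (h : ENNReal.ofReal c *
        (⨅ p ∈ {p : ℝ → ℝ → ℝ | ContDiffOn ℝ 2 (Function.uncurry p) {z : ℝ × ℝ | z.2 < -1 - |z.1|} ∧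
        (∀ z ∈ {z : ℝ × ℝ | z.2 < -1 - |z.1|}, iteratedDeriv 2 (fun τ => p τ z.2) z.1
          - iteratedDeriv 2 (p z.1) z.2 + V z.2 * p z.1 z.2 = 0) ∧
        ∃ (N : ℕ) (a : ℕ → ℝ → ℝ), ∀ z ∈ {z : ℝ × ℝ | z.2 < -1 - |z.1|},
          p z.1 z.2 = ∑ i ∈ Finset.range N, a i z.2 * z.1 ^ i},
          ∫⁻ x in Iio (-1), ENNReal.ofReal (deriv (fun τ => ψ τ x - p τ x) 0 ^ 2
            + deriv (fun y => ψ 0 y - p 0 y) x ^ 2 + V x * (ψ 0 x - p 0 x) ^ 2))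
      ≤ liminf (fun t => ∫⁻ x in Iio (-1 - |t|), ENNReal.ofReal (deriv (fun τ => ψ τ x) t ^ 2 + deriv (ψ t) x ^ 2 + V x * ψ t x ^ 2)) atTop
        + liminf (fun t => ∫⁻ x in Iio (-1 - |t|), ENNReal.ofReal (deriv (fun τ => ψ τ x) t ^ 2 + deriv (ψ t) x ^ 2 + V x * ψ t x ^ 2)) atBot) :
    ENNReal.ofReal c *
        (⨅ p ∈ {p : ℝ → ℝ → ℝ | ContDiffOn ℝ 2 (Function.uncurry p) {z : ℝ × ℝ | 1 + |z.1| < z.2} ∧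
        (∀ z ∈ {z : ℝ × ℝ | 1 + |z.1| < z.2}, iteratedDeriv 2 (fun τ => p τ z.2) z.1
          - iteratedDeriv 2 (p z.1) z.2 + W z.2 * p z.1 z.2 = 0) ∧
        ∃ (N : ℕ) (a : ℕ → ℝ → ℝ), ∀ z ∈ {z : ℝ × ℝ | 1 + |z.1| < z.2},
          p z.1 z.2 = ∑ i ∈ Finset.range N, a i z.2 * z.1 ^ i},
          ∫⁻ y in Ioi 1, ENNReal.ofReal (deriv (fun τ => φ τ y - p τ y) 0 ^ 2
            + deriv (fun y => φ 0 y - p 0 y) y ^ 2 + W y * (φ 0 y - p 0 y) ^ 2))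
      ≤ liminf (fun t => ∫⁻ y in Ioi (1 + |t|), ENNReal.ofReal (deriv (fun τ => φ τ y) t ^ 2 + deriv (φ t) y ^ 2 + W y * φ t y ^ 2)) atTop
        + liminf (fun t => ∫⁻ y in Ioi (1 + |t|), ENNReal.ofReal (deriv (fun τ => φ τ y) t ^ 2 + deriv (φ t) y ^ 2 + W y * φ t y ^ 2)) atBot := by
  have hψf : ψ = fun t x => φ t (-x) := funext fun t => funext fun x => hψφ t x
  have hVf : V = fun x => W (-x) := funext hVW
  subst hψf hVf
  -- the channel energies agree
  have hE : ∀ t, (∫⁻ x in Iio (-1 - |t|), ENNReal.ofReal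
      (deriv (fun τ => (fun t x => φ t (-x)) τ x) t ^ 2 + deriv ((fun t x => φ t (-x)) t) x ^ 2
        + (fun x => W (-x)) x * (fun t x => φ t (-x)) t x ^ 2))
      = ∫⁻ y in Ioi (1 + |t|), ENNReal.ofReal (deriv (fun τ => φ τ y) t ^ 2 + deriv (φ t) y ^ 2 + W y * φ t y ^ 2) := by
    intro t
    rw [show -1 - |t| = -(1 + |t|) by ring,
      ← lintegral_Iio_reflect (fun y => ENNReal.ofReal (deriv (fun τ => φ τ y) t ^ 2 + deriv (φ t) y ^ 2 + W y * φ t y ^ 2)) (1 + |t|)]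
    refine lintegral_congr fun x => ?_
    simp only
    rw [deriv_comp_neg (φ t) x, even_two.neg_pow]
  simp only [hE] at h
  refine le_trans ?_ h
  refine mul_le_mul' le_rfl (le_iInf₂ fun q hq => ?_)
  obtain ⟨hqC, hqsol, N, co, hco⟩ := hq
  -- the reflected kernel element
  set p : ℝ → ℝ → ℝ := fun t y => q t (-y) with hp
  have hpmem : p ∈ {p : ℝ → ℝ → ℝ | ContDiffOn ℝ 2 (Function.uncurry p) {z : ℝ × ℝ | 1 + |z.1| < z.2} ∧
        (∀ z ∈ {z : ℝ × ℝ | 1 + |z.1| < z.2}, iteratedDeriv 2 (fun τ => p τ z.2) z.1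
          - iteratedDeriv 2 (p z.1) z.2 + W z.2 * p z.1 z.2 = 0) ∧
        ∃ (N : ℕ) (a : ℕ → ℝ → ℝ), ∀ z ∈ {z : ℝ × ℝ | 1 + |z.1| < z.2},
          p z.1 z.2 = ∑ i ∈ Finset.range N, a i z.2 * z.1 ^ i} := by
    refine ⟨?_, ?_, ?_⟩
    · have hmap : ContDiff ℝ 2 (fun z : ℝ × ℝ => (z.1, -z.2)) := contDiff_fst.prodMk contDiff_snd.neg
      have hmaps : MapsTo (fun z : ℝ × ℝ => (z.1, -z.2)) {z : ℝ × ℝ | 1 + |z.1| < z.2} {z : ℝ × ℝ | z.2 < -1 - |z.1|} := by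
        intro z hz
        have h1 : 1 + |z.1| < z.2 := hz
        show -z.2 < -1 - |z.1|
        linarith
      have hcomp : Function.uncurry p = Function.uncurry q ∘ fun z : ℝ × ℝ => (z.1, -z.2) := by
        funext z; rfl
      rw [hcomp]
      exact hqC.comp hmap.contDiffOn hmaps
    · intro z hz
      have h1 : 1 + |z.1| < z.2 := hz
      have hz' : (z.1, -z.2) ∈ {z : ℝ × ℝ | z.2 < -1 - |z.1|} := by
        show -z.2 < -1 - |z.1|
        linarith
      have hs := hqsol (z.1, -z.2) hz'
      simp only at hs
      show iteratedDeriv 2 (fun τ => q τ (-z.2)) z.1 - iteratedDeriv 2 (fun y => q z.1 (-y)) z.2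
        + W z.2 * q z.1 (-z.2) = 0
      rw [iteratedDeriv_comp_neg 2 (q z.1) z.2]
      simp only [even_two.neg_one_pow, one_smul, neg_neg] at hs ⊢
      exact hs
    · exact ⟨N, fun i y => co i (-y), fun z hz => by
        have h1 : 1 + |z.1| < z.2 := hz
        have hz' : (z.1, -z.2) ∈ {z : ℝ × ℝ | z.2 < -1 - |z.1|} := by
          show -z.2 < -1 - |z.1|
          linarith
        simpa only [hp] using hco (z.1, -z.2) hz'⟩
  refine (iInf₂_le p hpmem).trans (le_of_eq ?_)
  -- the two initial deviations agree
  rw [show (-1 : ℝ) = -(1 : ℝ) by ring,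
    ← lintegral_Iio_reflect (fun y => ENNReal.ofReal (deriv (fun τ => φ τ y - p τ y) 0 ^ 2
      + deriv (fun y => φ 0 y - p 0 y) y ^ 2 + W y * (φ 0 y - p 0 y) ^ 2)) 1]
  refine lintegral_congr fun x => ?_
  have e2 : deriv (fun y => φ 0 y - p 0 y) (-x) ^ 2 = deriv (fun y => φ 0 (-y) - q 0 y) x ^ 2 := by
    have : (fun y => φ 0 (-y) - q 0 y) = fun y => (fun y' => φ 0 y' - p 0 y') (-y) := by
      funext y; simp only [hp, neg_neg]
    rw [this, deriv_comp_neg (fun y' => φ 0 y' - p 0 y') x, even_two.neg_pow]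
  rw [e2]
  simp only [hp, neg_neg]

/-! ### The unit-scale far channel estimate for `ℓ = 0` -/

/-- **Unit-scale far channel estimate for a small non-negative potential** (`n = 0`): for
`0 ≤ W ≤ ε y^{−5/2}` on `y ≥ ½` (`ε ≤ 1/25600`) and every global `C²` solution of
`φ_tt − φ_yy + Wφ = 0`, with constant `1/4`. -/
theorem unitFarChannel_zero {W : ℝ → ℝ} (hWc : Continuous W) (hW0 : ∀ y, 0 ≤ W y) {ε : ℝ}
    (hε : 0 < ε) (hεs : ε ≤ 1 / 25600)
    (hWε : ∀ y : ℝ, 1 / 2 ≤ y → W y ≤ ε * y ^ (-(5 : ℝ) / 2)) {φ : ℝ → ℝ → ℝ}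
    (hφ : ContDiff ℝ 2 (Function.uncurry φ))
    (hsol : ∀ t y, iteratedDeriv 2 (fun τ => φ τ y) t - iteratedDeriv 2 (φ t) y + W y * φ t y = 0) :
    ENNReal.ofReal (1 / 4) *
        (⨅ p ∈ {p : ℝ → ℝ → ℝ | ContDiffOn ℝ 2 (Function.uncurry p) {z : ℝ × ℝ | 1 + |z.1| < z.2} ∧
        (∀ z ∈ {z : ℝ × ℝ | 1 + |z.1| < z.2}, iteratedDeriv 2 (fun τ => p τ z.2) z.1
          - iteratedDeriv 2 (p z.1) z.2 + W z.2 * p z.1 z.2 = 0) ∧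
        ∃ (N : ℕ) (a : ℕ → ℝ → ℝ), ∀ z ∈ {z : ℝ × ℝ | 1 + |z.1| < z.2},
          p z.1 z.2 = ∑ i ∈ Finset.range N, a i z.2 * z.1 ^ i},
          ∫⁻ y in Ioi 1, ENNReal.ofReal (deriv (fun τ => φ τ y - p τ y) 0 ^ 2
            + deriv (fun y => φ 0 y - p 0 y) y ^ 2 + W y * (φ 0 y - p 0 y) ^ 2))
      ≤ liminf (fun t => ∫⁻ y in Ioi (1 + |t|), ENNReal.ofReal (deriv (fun τ => φ τ y) t ^ 2 + deriv (φ t) y ^ 2 + W y * φ t y ^ 2)) atTop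
        + liminf (fun t => ∫⁻ y in Ioi (1 + |t|), ENNReal.ofReal (deriv (fun τ => φ τ y) t ^ 2 + deriv (φ t) y ^ 2 + W y * φ t y ^ 2)) atBot := by
  obtain ⟨hψC, hψsol, -⟩ := wave1D_spatialReflection hφ hsol
  have hVc : Continuous fun x => W (-x) := hWc.comp continuous_neg
  have hV0 : ∀ x, 0 ≤ W (-x) := fun x => hW0 _
  have hVε : ∀ x : ℝ, x ≤ -(1 / 2) → W (-x) ≤ ε * (-x) ^ (-(5 : ℝ) / 2) := fun x hx =>
    hWε (-x) (by linarith)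
  have hnear := nearChannel_zero_of_rpow_tail (V := fun x => W (-x)) (ψ := fun t x => φ t (-x))
    hVc hV0 hε hεs hVε hψC (fun t x => hψsol t x)
  exact farChannel_of_near_reflect (V := fun x => W (-x)) (W := W) (ψ := fun t x => φ t (-x)) (φ := φ)
    (fun x => rfl) (fun t x => rfl) hnear


/-! ### The far half for the mode `ℓ = 0`, and the item -/

/-- **The far half-line channel estimate for the mode `ℓ = 0`** — hypothesis `hfar` of
`fixedModeChannels_of_near_far`, verbatim after `s ≤ ℓ`, under `ℓ = 0`; rescaling to the unit far
cone as in `farHalfLineChannels_of_unitFarChannel`, fed with `unitFarChannel_zero`. -/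
theorem farHalfLineChannels_mode_zero (M : ℝ) (hM : 0 < M) (s ℓ : ℕ) (hs : s ≤ 2) (hsℓ : s ≤ ℓ)
    (hℓ0 : ℓ = 0) :
    ∃ ρ₀ : ℝ, 0 ≤ ρ₀ ∧ ∃ c : ℝ, 0 < c ∧ ∀ (r : ℝ → ℝ) (xc : ℝ), (∀ x, 2 * M < r x) → (∀ x, HasDerivAt r (1 - 2 * M / r x) x) → r xc = 3 * M → ∀ ρ : ℝ, ρ₀ ≤ ρ → ∀ ψ : ℝ → ℝ → ℝ, ContDiff ℝ 2 (Function.uncurry ψ) → let V : ℝ → ℝ := fun x => (1 - 2 * M / r x) * ((ℓ : ℝ) * ((ℓ : ℝ) + 1) / r x ^ 2 + (1 - (s : ℝ) ^ 2) * (2 * M) / r x ^ 3); let e : (ℝ → ℝ → ℝ) → ℝ → ℝ → ℝ := fun φ t x => deriv (fun τ => φ τ x) t ^ 2 + deriv (φ t) x ^ 2 + V x * φ t x ^ 2; let IsSol : (ℝ → ℝ → ℝ) → ℝ × ℝ → Prop := fun φ z => iteratedDeriv 2 (fun τ => φ τ z.2) z.1 - iteratedDeriv 2 (φ z.1) z.2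 + V z.2 * φ z.1 z.2 = 0; let Ω : Set (ℝ × ℝ) := {z | xc + ρ + |z.1| < z.2}; let P : Set (ℝ → ℝ → ℝ) := {p | ContDiffOn ℝ 2 (Function.uncurry p) Ω ∧ (∀ z ∈ Ω, IsSol p z) ∧ ∃ (N : ℕ) (a : ℕ → ℝ → ℝ), ∀ z ∈ Ω, p z.1 z.2 = ∑ i ∈ Finset.range N, a i z.2 * z.1 ^ i}; let Eext : ℝ → ENNReal := fun t => MeasureTheory.lintegral (MeasureTheory.volume.restrict (Set.Ioi (xc + ρ + |t|))) (fun x => ENNReal.ofReal (e ψ t x)); (∀ z, IsSol ψ z) → ENNReal.ofReal c * (⨅ p ∈ P, MeasureTheory.lintegral (MeasureTheory.volume.restrict (Set.Ioi (xc + ρ))) (fun x => ENNReal.ofReal (e (fun t y => ψ t y - p t y) 0 x))) ≤ Filter.liminf Eext Filter.atTop + Filter.liminf Eext Filter.atBot := by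
  have hε : (0 : ℝ) < 1 / 25600 := by norm_num
  have hεs : (1 / 25600 : ℝ) ≤ 1 / 25600 := le_rfl
  set ε : ℝ := 1 / 25600
  obtain ⟨ρ₀, hρ₀, hT⟩ := rwPotential_rescaled_close hM s ℓ hs hε
  refine ⟨ρ₀, hρ₀.le, 1 / 4, by norm_num, ?_⟩
  intro r xc hr hr' hxc ρ hρ ψ hψ V e IsSol Ω P Eext hsol
  have hρpos : 0 < ρ := lt_of_lt_of_le hρ₀ hρ
  -- the potential: continuity and sign
  have hrc : Continuous r := continuous_iff_continuousAt.2 fun x => (hr' x).continuousAt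
  have hr0 : ∀ x, r x ≠ 0 := fun x => (lt_trans (by positivity) (hr x)).ne'
  have hVc : Continuous V := by
    show Continuous fun x => (1 - 2 * M / r x) * ((ℓ : ℝ) * ((ℓ : ℝ) + 1) / r x ^ 2
      + (1 - (s : ℝ) ^ 2) * (2 * M) / r x ^ 3)
    exact (continuous_const.sub (continuous_const.div hrc hr0)).mul
      ((continuous_const.div (hrc.pow 2) fun x => pow_ne_zero 2 (hr0 x)).add
        (continuous_const.div (hrc.pow 3) fun x => pow_ne_zero 3 (hr0 x)))
  have hV0 : ∀ x, 0 ≤ V x := fun x => rwPotential_nonneg hM (hr x) hs hsℓ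
  -- the rescaled potential and wave
  set W : ℝ → ℝ := fun y => ρ ^ 2 * V (xc + ρ * y) with hW
  set φ : ℝ → ℝ → ℝ := fun τ y => ψ (ρ * τ) (xc + ρ * y) with hφ
  have hWc : Continuous W :=
    continuous_const.mul (hVc.comp (continuous_const.add (continuous_const.mul continuous_id)))
  have hW0 : ∀ y, 0 ≤ W y := fun y => mul_nonneg (sq_nonneg ρ) (hV0 _)
  have hWclose : ∀ y : ℝ, 1 / 2 ≤ y →
      |W y - (ℓ : ℝ) * ((ℓ : ℝ) + 1) / y ^ 2| ≤ ε * y ^ (-(5 : ℝ) / 2) :=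
    fun y hy => hT r xc hr hr' hxc ρ hρ y hy
  have hφC : ContDiff ℝ 2 (Function.uncurry φ) := by
    have : Function.uncurry φ = Function.uncurry ψ ∘ fun p : ℝ × ℝ => (ρ * p.1, xc + ρ * p.2) := by
      funext p; rfl
    rw [this]
    exact hψ.comp ((contDiff_const.mul contDiff_fst).prodMk
      (contDiff_const.add (contDiff_const.mul contDiff_snd)))
  have hφsol : ∀ t y, iteratedDeriv 2 (fun τ => φ τ y) t - iteratedDeriv 2 (φ t) y
      + W y * φ t y = 0 := by
    intro t y
    have h1 : iteratedDeriv 2 (fun τ => φ τ y) t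
        = ρ ^ 2 * iteratedDeriv 2 (fun σ => ψ σ (xc + ρ * y)) (ρ * t) := by
      have := iteratedDeriv_two_comp_affine (fun σ => ψ σ (xc + ρ * y)) ρ 0 t
      simp only [add_zero] at this
      exact this
    have h2 : iteratedDeriv 2 (φ t) y = ρ ^ 2 * iteratedDeriv 2 (ψ (ρ * t)) (xc + ρ * y) := by
      have e2 : φ t = fun y' => ψ (ρ * t) (ρ * y' + xc) := by
        funext y'; simp only [hφ, add_comm xc]
      rw [e2, iteratedDeriv_two_comp_affine (ψ (ρ * t)) ρ xc y, add_comm (ρ * y) xc]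
    have h0 : iteratedDeriv 2 (fun τ => ψ τ (xc + ρ * y)) (ρ * t)
        - iteratedDeriv 2 (ψ (ρ * t)) (xc + ρ * y) + V (xc + ρ * y) * ψ (ρ * t) (xc + ρ * y) = 0 :=
      hsol (ρ * t, xc + ρ * y)
    have hWy : W y * φ t y = ρ ^ 2 * (V (xc + ρ * y) * ψ (ρ * t) (xc + ρ * y)) := by
      simp only [hW, hφ]; ring
    rw [h1, h2, hWy]
    have : ρ ^ 2 * iteratedDeriv 2 (fun σ => ψ σ (xc + ρ * y)) (ρ * t)
        - ρ ^ 2 * iteratedDeriv 2 (ψ (ρ * t)) (xc + ρ * y)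
        + ρ ^ 2 * (V (xc + ρ * y) * ψ (ρ * t) (xc + ρ * y))
        = ρ ^ 2 * (iteratedDeriv 2 (fun τ => ψ τ (xc + ρ * y)) (ρ * t)
          - iteratedDeriv 2 (ψ (ρ * t)) (xc + ρ * y)
          + V (xc + ρ * y) * ψ (ρ * t) (xc + ρ * y)) := by ring
    rw [this, h0, mul_zero]
  -- the unit-scale inequality for `(W, φ)` and its transport back
  have hWε : ∀ y : ℝ, 1 / 2 ≤ y → W y ≤ ε * y ^ (-(5 : ℝ) / 2) := by
    intro y hy
    have h := hWclose y hy
    have h0 : (ℓ : ℝ) * ((ℓ : ℝ) + 1) / y ^ 2 = 0 := by rw [hℓ0]; simp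
    rw [h0, sub_zero] at h
    exact (le_abs_self _).trans h
  have key := unitFarChannel_zero hWc hW0 hε hεs hWε hφC hφsol
  exact farChannelInequality_of_unitScale (V := V) (ψ := ψ) (xc := xc) (c := 1 / 4) hρpos key

/-- **The far half-line channel estimate, all modes** — hypothesis `hfar` of
`fixedModeChannels_of_near_far`, verbatim. -/
theorem farHalfLineChannels :
    ∀ M : ℝ, 0 < M → ∀ (s ℓ : ℕ), s ≤ 2 → s ≤ ℓ → ∃ ρ₀ : ℝ, 0 ≤ ρ₀ ∧ ∃ c : ℝ, 0 < c ∧ ∀ (r : ℝ → ℝ) (xc : ℝ), (∀ x, 2 * M < r x) → (∀ x, HasDerivAt r (1 - 2 * M / r x) x) → r xc = 3 * M → ∀ ρ : ℝ, ρ₀ ≤ ρ → ∀ ψ : ℝ → ℝ → ℝ, ContDiff ℝ 2 (Function.uncurry ψ) → let V : ℝ → ℝ := fun x => (1 - 2 * M / r x) * ((ℓ : ℝ) * ((ℓ : ℝ) + 1) / r x ^ 2 + (1 - (s : ℝ) ^ 2) * (2 * M) / r x ^ 3); let e : (ℝ → ℝ → ℝ) → ℝ → ℝ → ℝ := fun φ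 t x => deriv (fun τ => φ τ x) t ^ 2 + deriv (φ t) x ^ 2 + V x * φ t x ^ 2; let IsSol : (ℝ → ℝ → ℝ) → ℝ × ℝ → Prop := fun φ z => iteratedDeriv 2 (fun τ => φ τ z.2) z.1 - iteratedDeriv 2 (φ z.1) z.2 + V z.2 * φ z.1 z.2 = 0; let Ω : Set (ℝ × ℝ) := {z | xc + ρ + |z.1| < z.2}; let P : Set (ℝ → ℝ → ℝ) := {p | ContDiffOn ℝ 2 (Function.uncurry p) Ω ∧ (∀ z ∈ Ω, IsSol p z) ∧ ∃ (N : ℕ) (a : ℕ → ℝ → ℝ), ∀ z ∈ Ω, p z.1 z.2 = ∑ i ∈ Finset.range N, a i z.2 * z.1 ^ i}; let Eext : ℝ → ENNReal := fun t => MeasureTheory.lintegral (MeasureTheory.volume.restrict (Set.Ioi (xc + ρ + |t|))) (fun x => ENNReal.ofReal (e ψ t x)); (∀ z, IsSol ψ z) → ENNReal.ofReal c * (⨅ p ∈ P, MeasureTheory.lintegral (MeasureTheory.volume.restrict (Set.Ioi (xc + ρ))) (fun x => ENNReal.ofReal (e (fun t y => ψ t y - p t y) 0 x))) ≤ Filter.liminf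 Eext Filter.atTop + Filter.liminf Eext Filter.atBot := by
  intro M hM s ℓ hs hsℓ
  rcases Nat.eq_zero_or_pos ℓ with h0 | hpos
  · exact farHalfLineChannels_mode_zero M hM s ℓ hs hsℓ h0
  · exact farHalfLineChannels_pos M hM s ℓ hs hsℓ hpos

/-- **`FixedModeChannels`** (item stmt-FinalStateConjecture-10048): the conclusion is VERBATIM the
body of the route decl `…Theses.PhotonSphereChannels.FixedModeChannels`. -/
theorem fixedModeChannels_proof :
    ∀ M : ℝ, 0 < M → ∀ (s ℓ : ℕ), s ≤ 2 → s ≤ ℓ → ∃ ρ₀ : ℝ, 0 ≤ ρ₀ ∧ ∃ c : ℝ, 0 < c ∧ ∀ (r : ℝ → ℝ) (xc : ℝ), (∀ x, 2 * M < r x) → (∀ x, HasDerivAt r (1 - 2 * M / r x) x) → r xc = 3 * M → ∀ ρ : ℝ, ρ₀ ≤ ρ → ∀ ψ : ℝ → ℝ → ℝ, ContDiff ℝ 2 (Function.uncurry ψ) → let V : ℝ → ℝ := fun x => (1 - 2 * M / r x) * ((ℓ : ℝ) * ((ℓ : ℝ) + 1) / r x ^ 2 + (1 - (s : ℝ) ^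 2) * (2 * M) / r x ^ 3); let e : (ℝ → ℝ → ℝ) → ℝ → ℝ → ℝ := fun φ t x => deriv (fun τ => φ τ x) t ^ 2 + deriv (φ t) x ^ 2 + V x * φ t x ^ 2; let IsSol : (ℝ → ℝ → ℝ) → ℝ × ℝ → Prop := fun φ z => iteratedDeriv 2 (fun τ => φ τ z.2) z.1 - iteratedDeriv 2 (φ z.1) z.2 + V z.2 * φ z.1 z.2 = 0; let Ω : Set (ℝ × ℝ) := {z | ρ + |z.1| < |z.2 - xc|}; let P : Set (ℝ → ℝ → ℝ) := {p | ContDiffOn ℝ 2 (Function.uncurry p) Ω ∧ (∀ z ∈ Ω, IsSol p z) ∧ ∃ (N : ℕ) (a : ℕ → ℝ → ℝ), ∀ z ∈ Ω, p z.1 z.2 = ∑ i ∈ Finset.range N, a i z.2 * z.1 ^ i}; let Eext : ℝ → ENNReal := fun t => MeasureTheory.lintegral (MeasureTheory.volume.restrict {x : ℝ | ρ + |t| < |x - xc|}) (fun x => ENNReal.ofReal (e ψ t x)); (∀ z, IsSol ψ z) → ENNReal.ofReal c * (⨅ p ∈ P, MeasureTheory.lintegral (MeasureTheory.volume.restrict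 {x : ℝ | ρ < |x - xc|}) (fun x => ENNReal.ofReal (e (fun t y => ψ t y - p t y) 0 x))) ≤ Filter.liminf Eext Filter.atTop + Filter.liminf Eext Filter.atBot :=
  fixedModeChannels_of_near_far nearHalfLineChannels farHalfLineChannels

end Summit.FinalStateConjecture.FinalStateConjecture.Theorems
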